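import Mathlib
import Summits.NavierStokesRegularity.NavierStokesRegularity.Theorems.EulerZoomLiouvillePowerGaugeEulerLiouvillePastIrrotational
import Literature.Analysis.FluidPDE.ClassicalSolution
import Literature.Analysis.FluidPDE.TaoEnstrophyLocalisation
import Literature.Analysis.FluidPDE.AxisymmetricEuler
import Literature.Analysis.FluidPDE.SqIntegralBalance
import HarnessLib

/-!
# Crux `EulerZoomLiouville.PowerGaugeEulerLiouville` (stmt-NavierStokesRegularity-19832), line `swirlfree-ledger`, stub S3:
# THE LEDGER ENDGAME — a decaying AND monotone axis ledger forces an irrotational past, hence a trivial member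

Route №10 `EulerZoomLiouville` (NavierStokesRegularity), crux E.  Line `swirlfree-ledger` (ideator ns-idea-11;
`Cruxes/PowerGaugeEulerLiouville/Lines/swirlfree_ledger.lean`), registered stub `stub_ledgerEndgame` (S3), proved here with its
signature UNFOLDED in the tree's vocabulary (the line's abbreviations `InClass`, `LedgerDecay`, `LedgerMonotone`, `VanishesAE`,
`axisLedger v x = ‖curl v x‖ / cylRadius x` are `def`s of the Cruxes file; the statement below is their `δ`-unfolding, so the skeleton
fills the stub by `exact`).

THE ARGUMENT.  Let `f(τ, x) = |curl u(τ, x)| / r(x)` and `0 < q` with `3 − 3q − qρ/2 < 0` (this is `q > 6/(6+ρ)`).  Suppose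
(decay) `∫_{−a²}^{0} ∫_{B(a)} f^q ≤ C a^{5−3q−qρ/2}` for `a ≥ 1` and (monotone) for every `t₀ < 0`, `R₀ > 0` and all large `a`,
`X := ∫_{B(R₀)} f(t₀)^q ≤ ∫_{B(a)} f(t₁)^q` for every `t₁ ∈ (−a², t₀)`.  Averaging the monotone bound over `t₁ ∈ (−a², −a²/2)`
(a sub-window once `a² ≥ 2|t₀|`) gives `(a²/2) X ≤ C a^{5−3q−qρ/2}`, i.e. `X ≤ 2C a^{3−3q−qρ/2} → 0`: `X = 0`
(`setLIntegral_ledger_eq_zero`).  So `f(t₀, ·)^q = 0` a.e. on every ball; the symmetry axis `{r = 0}` is a null set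
(`volume_setOf_cylRadius_eq_zero`), hence `curl u(t₀) = 0` a.e., and by continuity everywhere (`curl_eq_zero_of_setLIntegral_eq_zero`).  The member
thus has an irrotational incompressible `C^∞` past (`T₁ = 0`), and the lead's LANDED filler
`PastIrrotational.ae_eq_zero_of_gauge_of_pastIrrotational` (crux hypotheses verbatim + irrotational incompressible `C²` slices ⇒ `u = 0`
a.e.) concludes — BY NAME, with the filler signature `(hρ) (hρ3) (hsw) (hH) (hgauge) (hT₁ := le_rfl) (hC2) (hdiv) (hcurl)` (critic price P4‴).

* `curl_eq_zero_of_setLIntegral_eq_zero` — `∫_{B(0,R)} (|curl v|/r)^q = 0` for all `R` and `curl v` continuous ⇒ `curl v ≡ 0`;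
* `setLIntegral_ledger_eq_zero` — decay + monotonicity ⇒ `∫_{B(R₀)} f(t₀)^q = 0`;
* **`ledgerEndgame_of_classical`** — the stub signature, unfolded.

WHAT THIS IS NOT: not NS, not the crux — a helper `--supports` stmt-19832 on the line `swirlfree-ledger` (its hypotheses (decay) and
(monotone) are the line's stubs S1, S2); no summit statement is proved here.  [folklore]
-/

noncomputable section

-- flat `Theorems/<Route><Decl>…` files of one crux share the namespace of the crux (tree convention)
set_option linter.dupNamespace false

open MeasureTheory Set Filter Topology Metric Function
open scoped NNReal ENNReal

namespace Summit.NavierStokesRegularity.NavierStokesRegularity.Theorems.PowerGaugeEulerLiouville.SwirlfreeLedger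

open Literature.Analysis Literature.Analysis.FluidPDE

variable {u : ℝ → EuclideanSpace ℝ (Fin 3) → EuclideanSpace ℝ (Fin 3)} {p : ℝ → EuclideanSpace ℝ (Fin 3) → ℝ}
  {H : ℝ → EuclideanSpace ℝ (Fin 3) → EuclideanSpace ℝ (Fin 3) →L[ℝ] EuclideanSpace ℝ (Fin 3)}

/-! ### A vanishing `q`-ledger on every ball forces `curl ≡ 0` -/

/-- If `curl v` is continuous and `∫_{B(0,R)} (|curl v| / r)^q dx = 0` for every `R > 0` (`q > 0`), then `curl v ≡ 0`: the density
vanishes a.e. on each ball, off the null axis this says `curl v = 0` a.e., and a continuous function vanishing a.e. on a ball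
vanishes on it (an open set where it is non-zero would have positive measure).  (`q` is arbitrary: for `q = 0` the hypothesis is
absurd.) [folklore] -/
theorem curl_eq_zero_of_setLIntegral_eq_zero {v : EuclideanSpace ℝ (Fin 3) → EuclideanSpace ℝ (Fin 3)}
    (hv : Continuous (curl v)) {q : ℝ}
    (h0 : ∀ R : ℝ, 0 < R →
      ∫⁻ x in ball (0 : EuclideanSpace ℝ (Fin 3)) R, ENNReal.ofReal ((‖curl v x‖ / cylRadius x) ^ q) = 0) :
    ∀ x, curl v x = 0 := by
  intro x₁
  by_contra hx₁
  set B : Set (EuclideanSpace ℝ (Fin 3)) := ball 0 (‖x₁‖ + 1) with hB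
  have hx₁B : x₁ ∈ B := by
    rw [hB, mem_ball_zero_iff]; linarith
  have hmeas : AEMeasurable (fun x : EuclideanSpace ℝ (Fin 3) => ENNReal.ofReal ((‖curl v x‖ / cylRadius x) ^ q))
      (volume.restrict B) :=
    (((hv.measurable.norm.div continuous_cylRadius.measurable).pow_const q).ennreal_ofReal).aemeasurable
  have h1 : ∀ᵐ x ∂(volume.restrict B), ENNReal.ofReal ((‖curl v x‖ / cylRadius x) ^ q) = 0 := by
    have := (lintegral_eq_zero_iff' hmeas).1 (h0 _ (by positivity))
    filter_upwards [this] with x hx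
    exact hx
  have hax : ∀ᵐ x ∂(volume : Measure (EuclideanSpace ℝ (Fin 3))), cylRadius x ≠ 0 := by
    rw [ae_iff]
    refine measure_mono_null (fun x hx => ?_) volume_setOf_cylRadius_eq_zero
    simpa using hx
  have h2 : ∀ᵐ x ∂(volume.restrict B), curl v x = 0 := by
    filter_upwards [h1, ae_restrict_of_ae hax] with x hx hr
    have hf0 : 0 ≤ ‖curl v x‖ / cylRadius x := div_nonneg (norm_nonneg _) (cylRadius_nonneg _)
    rw [ENNReal.ofReal_eq_zero] at hx
    have hfq : (‖curl v x‖ / cylRadius x) ^ q = 0 := le_antisymm hx (Real.rpow_nonneg hf0 _)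
    rw [Real.rpow_eq_zero_iff_of_nonneg hf0, div_eq_zero_iff] at hfq
    rcases hfq.1 with h | h
    · exact norm_eq_zero.1 h
    · exact absurd h hr
  have hO : IsOpen {x : EuclideanSpace ℝ (Fin 3) | curl v x ≠ 0} := isOpen_ne_fun hv continuous_const
  have hpos : 0 < volume ({x : EuclideanSpace ℝ (Fin 3) | curl v x ≠ 0} ∩ B) :=
    (hO.inter isOpen_ball).measure_pos volume ⟨x₁, hx₁, hx₁B⟩
  have hzero : volume ({x : EuclideanSpace ℝ (Fin 3) | curl v x ≠ 0} ∩ B) = 0 := by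
    rw [← Measure.restrict_apply hO.measurableSet]
    exact ae_iff.1 h2
  exact hpos.ne' hzero

/-! ### Decay + monotonicity ⇒ the slice ledger vanishes -/

/-- **Averaging the monotone ledger against the windowed decay.**  For `f ≥ 0` (here `f(τ,x) = |curl u(τ,x)|/r(x)`, but only the
two displayed hypotheses are used), an exponent `e < 2` (here `e = 5 − 3q − qρ/2`, `e − 2 = 3 − 3q − qρ/2 < 0`), the decay
`∫_{−a²}^{0}∫_{B(a)} f^q ≤ C a^{e}` (`a ≥ 1`) and the monotonicity `X := ∫_{B(R₀)} f(t₀)^q ≤ ∫_{B(a)} f(t₁)^q` for `a ≥ A₀`,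
`t₁ ∈ (−a², t₀)`, one gets `X = 0`: average over `t₁ ∈ (−a², −a²/2)` (`a² ≥ 2|t₀|`), `(a²/2)·X ≤ C a^{e}`, `X ≤ 2C a^{e−2} → 0`. [folklore] -/
theorem setLIntegral_ledger_eq_zero {F : ℝ → EuclideanSpace ℝ (Fin 3) → ℝ≥0∞} {e : ℝ} (he : e < 2) {C : ℝ≥0}
    (hdecay : ∀ a : ℝ, 1 ≤ a →
      ∫⁻ τ in Ioo (-a ^ 2) 0, ∫⁻ x in ball (0 : EuclideanSpace ℝ (Fin 3)) a, F τ x ≤ (C : ℝ≥0∞) * ENNReal.ofReal (a ^ e))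
    {t₀ : ℝ} (ht₀ : t₀ < 0) {R₀ A₀ : ℝ}
    (hmono : ∀ a : ℝ, A₀ ≤ a → ∀ t₁ ∈ Ioo (-a ^ 2) t₀,
      ∫⁻ x in ball (0 : EuclideanSpace ℝ (Fin 3)) R₀, F t₀ x ≤ ∫⁻ x in ball (0 : EuclideanSpace ℝ (Fin 3)) a, F t₁ x) :
    ∫⁻ x in ball (0 : EuclideanSpace ℝ (Fin 3)) R₀, F t₀ x = 0 := by
  set X : ℝ≥0∞ := ∫⁻ x in ball (0 : EuclideanSpace ℝ (Fin 3)) R₀, F t₀ x with hX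
  -- the threshold: `a ≥ A₁` gives `a ≥ A₀`, `a ≥ 1` and `a² ≥ 2|t₀|`
  set A₁ : ℝ := max (max A₀ 1) (Real.sqrt (-2 * t₀)) with hA₁
  have hbound : ∀ a : ℝ, A₁ ≤ a → X ≤ (C : ℝ≥0∞) * ENNReal.ofReal (2 * a ^ (e - 2)) := by
    intro a ha
    have hA₀a : A₀ ≤ a := le_trans (le_trans (le_max_left _ _) (le_max_left _ _)) ha
    have h1a : 1 ≤ a := le_trans (le_trans (le_max_right _ _) (le_max_left _ _)) ha
    have ha0 : 0 < a := by linarith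
    have hsq : -2 * t₀ ≤ a ^ 2 := by
      have h1 : Real.sqrt (-2 * t₀) ≤ a := le_trans (le_max_right _ _) ha
      have h2 : 0 ≤ Real.sqrt (-2 * t₀) := Real.sqrt_nonneg _
      calc -2 * t₀ = Real.sqrt (-2 * t₀) ^ 2 := (Real.sq_sqrt (by linarith)).symm
        _ ≤ a ^ 2 := pow_le_pow_left₀ h2 h1 2
    -- averaging over `t₁ ∈ (-a², -a²/2) ⊆ (-a², t₀)`
    have hsub : Ioo (-a ^ 2) (-a ^ 2 / 2) ⊆ Ioo (-a ^ 2) t₀ := Ioo_subset_Ioo le_rfl (by linarith)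
    have havg : X * ENNReal.ofReal (a ^ 2 / 2) ≤ (C : ℝ≥0∞) * ENNReal.ofReal (a ^ e) :=
      calc X * ENNReal.ofReal (a ^ 2 / 2)
          = ∫⁻ _ in Ioo (-a ^ 2) (-a ^ 2 / 2), X := by
            rw [setLIntegral_const, Real.volume_Ioo]
            congr 2
            ring
        _ ≤ ∫⁻ t₁ in Ioo (-a ^ 2) (-a ^ 2 / 2), ∫⁻ x in ball (0 : EuclideanSpace ℝ (Fin 3)) a, F t₁ x :=
            setLIntegral_mono' measurableSet_Ioo fun t₁ ht₁ => hmono a hA₀a t₁ (hsub ht₁)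
        _ ≤ ∫⁻ t₁ in Ioo (-a ^ 2) 0, ∫⁻ x in ball (0 : EuclideanSpace ℝ (Fin 3)) a, F t₁ x :=
            lintegral_mono_set (Ioo_subset_Ioo le_rfl (by nlinarith))
        _ ≤ (C : ℝ≥0∞) * ENNReal.ofReal (a ^ e) := hdecay a h1a
    have hpos : 0 < a ^ 2 / 2 := by positivity
    have hne0 : ENNReal.ofReal (a ^ 2 / 2) ≠ 0 := (ENNReal.ofReal_pos.2 hpos).ne'
    calc X = X * ENNReal.ofReal (a ^ 2 / 2) / ENNReal.ofReal (a ^ 2 / 2) := by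
          rw [ENNReal.mul_div_cancel_right hne0 ENNReal.ofReal_ne_top]
      _ ≤ (C : ℝ≥0∞) * ENNReal.ofReal (a ^ e) / ENNReal.ofReal (a ^ 2 / 2) := by gcongr
      _ = (C : ℝ≥0∞) * ENNReal.ofReal (2 * a ^ (e - 2)) := by
          rw [mul_div_assoc, ← ENNReal.ofReal_div_of_pos hpos]
          congr 2
          rw [Real.rpow_sub ha0, Real.rpow_two]
          field_simp
  -- the right side tends to `0`
  have hlim : Tendsto (fun a : ℝ => (C : ℝ≥0∞) * ENNReal.ofReal (2 * a ^ (e - 2))) atTop (𝓝 0) := by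
    have h1 : Tendsto (fun a : ℝ => 2 * a ^ (e - 2)) atTop (𝓝 (2 * 0)) := by
      refine Tendsto.const_mul 2 ?_
      have := tendsto_rpow_neg_atTop (y := 2 - e) (by linarith)
      refine this.congr' ?_
      filter_upwards [eventually_gt_atTop 0] with a ha
      rw [show -(2 - e) = e - 2 by ring]
    rw [mul_zero] at h1
    have h2 : Tendsto (fun a : ℝ => ENNReal.ofReal (2 * a ^ (e - 2))) atTop (𝓝 0) := by
      rw [← ENNReal.ofReal_zero]
      exact ENNReal.tendsto_ofReal h1
    have h3 := ENNReal.Tendsto.const_mul (a := (C : ℝ≥0∞)) h2 (Or.inr ENNReal.coe_ne_top)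
    rwa [mul_zero] at h3
  have hle : X ≤ 0 :=
    ge_of_tendsto hlim (Filter.eventually_atTop.2 ⟨A₁, fun a ha => hbound a ha⟩)
  exact nonpos_iff_eq_zero.1 hle

/-! ### The stub, unfolded -/

/-- **S3 `stub_ledgerEndgame` of the line `swirlfree-ledger`, signature unfolded** (`InClass ρ u p H c`, `LedgerDecay ρ q u`,
`LedgerMonotone q u`, `VanishesAE u`, `axisLedger v x = ‖curl v x‖ / cylRadius x` are the line's abbreviations): for `0 < ρ ≤ 1/2`, a
member of the power-gauged class that is a classical Euler solution on `(−∞,0)` whose axis ledger is, for one `q ∈ (6/(6+ρ), 1)`,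
windowed-decaying AND monotone, is trivial: `u = 0` a.e. on `(−∞,0) × ℝ³`.  Proof: `setLIntegral_ledger_eq_zero` (with
`e = 5 − 3q − qρ/2 < 2 ⇔ q > 6/(6+ρ)`) + `curl_eq_zero_of_setLIntegral_eq_zero` give `curl u(τ) ≡ 0` for every `τ < 0`; slices are `C^∞`
and divergence free (`IsClassicalEulerSolutionOn`); conclude with the landed
`PastIrrotational.ae_eq_zero_of_gauge_of_pastIrrotational` at `T₁ = 0`. [folklore] -/
theorem ledgerEndgame_of_classical :
    ∀ ρ : ℝ, 0 < ρ → ρ ≤ 1 / 2 →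
      ∀ (u : ℝ → EuclideanSpace ℝ (Fin 3) → EuclideanSpace ℝ (Fin 3)) (p : ℝ → EuclideanSpace ℝ (Fin 3) → ℝ)
        (H : ℝ → EuclideanSpace ℝ (Fin 3) → EuclideanSpace ℝ (Fin 3) →L[ℝ] EuclideanSpace ℝ (Fin 3)) (c : ℝ≥0),
        (IsSuitableWeakSolutionOn (slab (EuclideanSpace ℝ (Fin 3)) (Set.Iio 0) isOpen_Iio) 0 0 u p ∧
            HasWeakSpatialGradientOn (slab (EuclideanSpace ℝ (Fin 3)) (Set.Iio 0) isOpen_Iio) u H ∧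
            (∀ a : ℝ, 0 < a →
              ENNReal.ofReal (a ^ (2 * ρ)) * cknA a (0 : ℝ × EuclideanSpace ℝ (Fin 3)) u +
                    ENNReal.ofReal (a ^ ρ) * cknE a (0 : ℝ × EuclideanSpace ℝ (Fin 3)) H +
                  ENNReal.ofReal (a ^ (2 * ρ)) * cknD a (0 : ℝ × EuclideanSpace ℝ (Fin 3)) p ≤ (c : ℝ≥0∞))) →
          IsClassicalEulerSolutionOn (Set.Iio 0) 0 u p →
            (∃ q : ℝ, 6 / (6 + ρ) < q ∧ q < 1 ∧
              (∃ C : ℝ≥0, ∀ a : ℝ, 1 ≤ a →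
                ∫⁻ τ in Set.Ioo (-a ^ 2) 0, ∫⁻ x in ball (0 : EuclideanSpace ℝ (Fin 3)) a,
                    ENNReal.ofReal ((‖curl (u τ) x‖ / cylRadius x) ^ q) ≤
                  (C : ℝ≥0∞) * ENNReal.ofReal (a ^ (5 - 3 * q - q * ρ / 2))) ∧
              (∀ t₀ : ℝ, t₀ < 0 → ∀ R₀ : ℝ, 0 < R₀ → ∃ A₀ : ℝ, 0 < A₀ ∧ ∀ a : ℝ, A₀ ≤ a →
                ∀ t₁ ∈ Set.Ioo (-a ^ 2) t₀,
                  ∫⁻ x in ball (0 : EuclideanSpace ℝ (Fin 3)) R₀, ENNReal.ofReal ((‖curl (u t₀) x‖ / cylRadius x) ^ q) ≤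
                    ∫⁻ x in ball (0 : EuclideanSpace ℝ (Fin 3)) a, ENNReal.ofReal ((‖curl (u t₁) x‖ / cylRadius x) ^ q))) →
              Function.uncurry u =ᵐ[volume.restrict (Set.Iio (0 : ℝ) ×ˢ (Set.univ : Set (EuclideanSpace ℝ (Fin 3))))] 0 := by
  intro ρ hρ hρ2 u p H c hcls hcl hq
  obtain ⟨hsw, hH, hgauge⟩ := hcls
  obtain ⟨q, hq1, hq2, ⟨C, hC⟩, hmono⟩ := hq
  have hq0 : 0 < q := lt_trans (by positivity) hq1
  -- `e = 5 - 3q - qρ/2 < 2` is exactly `q > 6/(6+ρ)`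
  have he : 5 - 3 * q - q * ρ / 2 < 2 := by
    have h6 : 6 < q * (6 + ρ) := by
      have := (div_lt_iff₀ (by linarith : (0 : ℝ) < 6 + ρ)).1 hq1
      linarith
    nlinarith
  -- every past slice is irrotational
  have hcurl : ∀ τ : ℝ, τ < 0 → ∀ x, curl (u τ) x = 0 := by
    intro τ hτ
    have hu1 : ContDiff ℝ 1 (u τ) := (hcl.contDiff_velocity hτ).of_le (by exact_mod_cast le_top)
    have hcont : Continuous (curl (u τ)) := by
      rw [curl_eq_curlCLM_comp]
      exact curlCLM.continuous.comp (hu1.continuous_fderiv one_ne_zero)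
    refine curl_eq_zero_of_setLIntegral_eq_zero hcont (q := q) fun R hR => ?_
    obtain ⟨A₀, -, hA₀⟩ := hmono τ hτ R hR
    exact setLIntegral_ledger_eq_zero (F := fun t x => ENNReal.ofReal ((‖curl (u t) x‖ / cylRadius x) ^ q)) he hC hτ hA₀
  have hC2 : ∀ τ : ℝ, τ < 0 → ContDiff ℝ 2 (u τ) := fun τ hτ =>
    (hcl.contDiff_velocity hτ).of_le (by norm_cast)
  have hdiv : ∀ τ : ℝ, τ < 0 → VectorCalculus.IsDivFree (u τ) := fun τ hτ => hcl.divFree τ hτ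
  exact PastIrrotational.ae_eq_zero_of_gauge_of_pastIrrotational hρ hρ2 hsw hH hgauge (T₁ := 0) le_rfl hC2 hdiv hcurl

end Summit.NavierStokesRegularity.NavierStokesRegularity.Theorems.PowerGaugeEulerLiouville.SwirlfreeLedger

end
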